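import Summits.AtomisticToContinuum.FouriersLaw.Theorems.JunctionLocalityNonBallisticStubMidpointContraction
import Summits.AtomisticToContinuum.FouriersLaw.Theorems.JunctionLocalityNonBallisticProfileAntitone
import Literature.MathematicalPhysics.KineticTheory.VelocityFlipNoise

/-!
# `NonBallistic` / light cone, assembly part 1: flip-insensitivity of the kernels from the pathwise mean square

Helper (`--supports stmt-AtomisticToContinuum-9127`) for stub `stub_lightConeWindow` (LC) of line `contact-current-forgetting`.
The LC stub is reduced (landed `lightConeWindow_of_flipInsensitivity`, `…StubLightConeWindowAux3`) to the KERNEL-LEVEL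
flip-insensitivity statement (FS): `∫ (κ_s j_k(x) − κ_s j_k(Θ₀(Θ₁x)))² dμ_T(x) ≤ ε` for `N ≥ N₀(t⋆, ε)`, `s ≤ t⋆`, `k = N-2`.
Since `κ_s g(x) = E_W[g(Φ_s(x,W))]` (`pinnedChain_integral_transitionKernel`), Jensen turns (FS) into a statement about TWO
STRONG SOLUTIONS driven by the SAME Brownian pair from `x` and from the flipped start — the synchronous coupling. This file
proves exactly that reduction, in the robust `ℝ≥0∞` form:

* `flipInsensitivity_of_pathwise` — if the iterated LEBESGUE integral
  `∫⁻ x, ∫⁻ ω, ofReal ((j_k(Φ_s(x,B ω)) − j_k(Φ_s(Θ₀Θ₁x, B ω)))²) dW dμ_T ≤ ofReal ε` for `N ≥ N₀`, `s ≤ t⋆`, then (FS)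
  (verbatim the hypothesis of `lightConeWindow_of_flipInsensitivity`).

Pointwise Jensen `(∫ h dW)² ≤ ∫ h² dW` (`ProfileAntitone.sq_integral_le_integral_sq`) needs `h = j_k∘Φ_s(x,·) − j_k∘Φ_s(x̃,·)`
and `h²` to be `W`-integrable for EVERY `x`: the bond current is continuous of exponential class, and `e^{θH}` is integrable
against every `κ_s(x,·)` (`pinnedChain_integrable_exp_mul_hamiltonian_transitionKernel`), transported to the Wiener space by
`pinnedChain_transitionKernel_apply` + `integrable_map_measure`. The passage Bochner → Lebesgue uses that a non-integrable
nonnegative integrand has Bochner integral `0 ≤ ε`.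
-/

noncomputable section

namespace Summit.AtomisticToContinuum.FouriersLaw.Theorems.NonBallistic

open MeasureTheory ProbabilityTheory Set Filter Topology
open scoped NNReal ENNReal
open Literature.MathematicalPhysics.KineticTheory.HeatConduction
open Literature.Probability.Process
open Summit.AtomisticToContinuum.FouriersLaw.Theorems.SubdiffusiveBondHeat

namespace FSAssembly

variable {ω₂ lam β γ : ℝ} (hω : 0 < ω₂) (hl : 0 ≤ lam) (hβ : 0 < β) (hγ : 0 < γ) {N : ℕ} (hN : 0 < N)
  {T : ℝ} (hT : 0 < T)

include hω hl hβ hγ hN hT in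
/-- For every start `x`, the bond current along the strong solution, `ω ↦ j_k(Φ_s(x, B ω))`, is in `L¹ ∩ L²(W)`. -/
theorem integrable_bondCurrent_solMap (k : Fin N) (s : ℝ≥0) (x : PhaseSpace N) :
    Integrable (fun ω => (pinnedChain ω₂ lam β γ).bondCurrent N k
        ((pinnedChain ω₂ lam β γ).solMap N T T s x (pairPath ω))) wienerPair ∧
      Integrable (fun ω => (pinnedChain ω₂ lam β γ).bondCurrent N k
        ((pinnedChain ω₂ lam β γ).solMap N T T s x (pairPath ω)) ^ 2) wienerPair := by
  set P := pinnedChain ω₂ lam β γ with hP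
  -- exponential class with ϑ = 1/(4T): j and j² are integrable against κ_s(x,·)
  have hϑ0 : 0 < 1 / (4 * T) := by positivity
  have hϑ1 : 1 / (4 * T) < 1 / T := one_div_lt_one_div_of_lt hT (by linarith)
  have h2ϑ1 : 2 * (1 / (4 * T)) < 1 / T := by
    rw [show 2 * (1 / (4 * T)) = 1 / (2 * T) by field_simp; ring]
    exact one_div_lt_one_div_of_lt hT (by linarith)
  have h2ϑ0 : 0 < 2 * (1 / (4 * T)) := by positivity
  obtain ⟨K, hK, hKb⟩ := FiniteResponse.abs_bondCurrent_le_exp hω hl hβ hN hϑ0 k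
  have hcont : Continuous (P.bondCurrent N k) := pinnedChain_continuous_bondCurrent ω₂ lam β γ N k
  have hint1 : Integrable (P.bondCurrent N k) (P.transitionKernel N T T s x) :=
    integrable_of_abs_le_exp
      (pinnedChain_integrable_exp_mul_hamiltonian_transitionKernel hω hl hT hβ.le hγ.le hN hϑ0 hϑ1 s x) hcont hKb
  have hKb2 : ∀ y, |P.bondCurrent N k y ^ 2| ≤ K ^ 2 * Real.exp (2 * (1 / (4 * T)) * P.hamiltonian N y) := by
    intro y
    rw [abs_pow, show K ^ 2 * Real.exp (2 * (1 / (4 * T)) * P.hamiltonian N y) =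
      (K * Real.exp (1 / (4 * T) * P.hamiltonian N y)) ^ 2 by rw [mul_pow, ← Real.exp_nat_mul]; ring_nf]
    exact pow_le_pow_left₀ (abs_nonneg _) (hKb y) 2
  have hint2 : Integrable (fun y => P.bondCurrent N k y ^ 2) (P.transitionKernel N T T s x) :=
    integrable_of_abs_le_exp
      (pinnedChain_integrable_exp_mul_hamiltonian_transitionKernel hω hl hT hβ.le hγ.le hN h2ϑ0 h2ϑ1 s x)
      (hcont.pow 2) hKb2
  have hmeas := pinnedChain_measurable_solMap_pairPath_right hω hl hβ.le hγ.le N T T s x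
  rw [pinnedChain_transitionKernel_apply hω hl hβ.le hγ.le] at hint1 hint2
  exact ⟨(integrable_map_measure hcont.aestronglyMeasurable hmeas.aemeasurable).1 hint1,
    (integrable_map_measure (hcont.pow 2).aestronglyMeasurable hmeas.aemeasurable).1 hint2⟩

include hω hl hβ hγ hN hT in
/-- Pointwise Jensen for the synchronous coupling: for every pair of starts `x, x̃`,
`(κ_s j_k(x) − κ_s j_k(x̃))² ≤ ∫ (j_k(Φ_s(x,Bω)) − j_k(Φ_s(x̃,Bω)))² dW(ω)`. -/
theorem sq_kernel_sub_le_integral_sq (k : Fin N) (s : ℝ≥0) (x x' : PhaseSpace N) :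
    ((∫ y, (pinnedChain ω₂ lam β γ).bondCurrent N k y ∂((pinnedChain ω₂ lam β γ).transitionKernel N T T s x)) -
        ∫ y, (pinnedChain ω₂ lam β γ).bondCurrent N k y ∂((pinnedChain ω₂ lam β γ).transitionKernel N T T s x')) ^ 2 ≤
      ∫ ω, ((pinnedChain ω₂ lam β γ).bondCurrent N k ((pinnedChain ω₂ lam β γ).solMap N T T s x (pairPath ω)) -
        (pinnedChain ω₂ lam β γ).bondCurrent N k ((pinnedChain ω₂ lam β γ).solMap N T T s x' (pairPath ω))) ^ 2
        ∂wienerPair := by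
  set P := pinnedChain ω₂ lam β γ with hP
  have hcont : Continuous (P.bondCurrent N k) := pinnedChain_continuous_bondCurrent ω₂ lam β γ N k
  obtain ⟨h1, h1sq⟩ := integrable_bondCurrent_solMap hω hl hβ hγ hN hT k s x
  obtain ⟨h2, h2sq⟩ := integrable_bondCurrent_solMap hω hl hβ hγ hN hT k s x'
  rw [pinnedChain_integral_transitionKernel hω hl hβ.le hγ.le N T T s x hcont.aestronglyMeasurable,
    pinnedChain_integral_transitionKernel hω hl hβ.le hγ.le N T T s x' hcont.aestronglyMeasurable,
    ← integral_sub h1 h2]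
  haveI : IsProbabilityMeasure wienerPair := by infer_instance
  refine ProfileAntitone.sq_integral_le_integral_sq (h1.sub h2) ?_
  -- (a - b)² ≤ 2a² + 2b² is integrable
  have hmeas : AEStronglyMeasurable (fun ω => (P.bondCurrent N k (P.solMap N T T s x (pairPath ω)) -
      P.bondCurrent N k (P.solMap N T T s x' (pairPath ω))) ^ 2) wienerPair :=
    ((h1.sub h2).aestronglyMeasurable.aemeasurable.pow_const 2).aestronglyMeasurable
  refine Integrable.mono' ((h1sq.const_mul 2).add (h2sq.const_mul 2)) hmeas (ae_of_all _ fun ω => ?_)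
  rw [Real.norm_eq_abs, abs_of_nonneg (sq_nonneg _)]
  simp only [Pi.add_apply]
  nlinarith [sq_nonneg (P.bondCurrent N k (P.solMap N T T s x (pairPath ω)) +
    P.bondCurrent N k (P.solMap N T T s x' (pairPath ω)))]

end FSAssembly

open FSAssembly in
/-- **Assembly, part 1 (line `contact-current-forgetting`, stub LC).** The kernel-level flip-insensitivity (FS) — verbatim
the hypothesis of `lightConeWindow_of_flipInsensitivity` — follows from its PATHWISE mean-square version for the synchronous
coupling (two strong solutions driven by the same Brownian pair, from `x` and from the doubly flipped start), stated with
Lebesgue integrals. -/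
theorem flipInsensitivity_of_pathwise :
    (∀ ω₂ lam β γ : ℝ, 0 < ω₂ → 0 < lam → 0 < β → 0 < γ → ∀ T : ℝ, 0 < T → ∀ tstar ε : ℝ, 0 < ε →
      ∃ N₀ : ℕ, ∀ (N : ℕ) (i i' k : Fin N), N₀ ≤ N → (i : ℕ) = 0 → (i' : ℕ) = 1 → (k : ℕ) = N - 2 →
        ∀ s : NNReal, (s : ℝ) ≤ tstar →
          ∫⁻ x, ∫⁻ ω, ENNReal.ofReal
              (((pinnedChain ω₂ lam β γ).bondCurrent N k
                  ((pinnedChain ω₂ lam β γ).solMap N T T s x (pairPath ω)) -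
                (pinnedChain ω₂ lam β γ).bondCurrent N k
                  ((pinnedChain ω₂ lam β γ).solMap N T T s (momentumFlip i (momentumFlip i' x)) (pairPath ω))) ^ 2)
              ∂wienerPair ∂((pinnedChain ω₂ lam β γ).gibbsMeasure N T) ≤ ENNReal.ofReal ε) →
    ∀ ω₂ lam β γ : ℝ, 0 < ω₂ → 0 < lam → 0 < β → 0 < γ → ∀ T : ℝ, 0 < T → ∀ tstar ε : ℝ, 0 < ε →
      ∃ N₀ : ℕ, ∀ (N : ℕ) (i i' k : Fin N), N₀ ≤ N → (i : ℕ) = 0 → (i' : ℕ) = 1 → (k : ℕ) = N - 2 →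
        ∀ s : NNReal, (s : ℝ) ≤ tstar →
          ∫ x, ((∫ y, (pinnedChain ω₂ lam β γ).bondCurrent N k y
                  ∂((pinnedChain ω₂ lam β γ).transitionKernel N T T s x)) -
              (∫ y, (pinnedChain ω₂ lam β γ).bondCurrent N k y
                ∂((pinnedChain ω₂ lam β γ).transitionKernel N T T s (momentumFlip i (momentumFlip i' x))))) ^ 2
            ∂((pinnedChain ω₂ lam β γ).gibbsMeasure N T) ≤ ε := by
  intro hpath ω₂ lam β γ hω hl hβ hγ T hT tstar ε hε
  obtain ⟨N₀, hN₀⟩ := hpath ω₂ lam β γ hω hl hβ hγ T hT tstar ε hε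
  refine ⟨max N₀ 1, fun N i i' k hN hi hi' hk s hs => ?_⟩
  have hNN₀ : N₀ ≤ N := le_trans (le_max_left _ _) hN
  have hN0 : 0 < N := lt_of_lt_of_le (lt_of_lt_of_le one_pos (le_max_right N₀ 1)) hN
  set P := pinnedChain ω₂ lam β γ with hP
  set μ := P.gibbsMeasure N T with hμ
  set F : PhaseSpace N → ℝ := fun x =>
    ((∫ y, P.bondCurrent N k y ∂(P.transitionKernel N T T s x)) -
      ∫ y, P.bondCurrent N k y ∂(P.transitionKernel N T T s (momentumFlip i (momentumFlip i' x)))) ^ 2 with hF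
  have hF0 : ∀ x, 0 ≤ F x := fun x => sq_nonneg _
  have key := hN₀ N i i' k hNN₀ hi hi' hk s hs
  -- pointwise Jensen, in `ℝ≥0∞`
  have hpt : ∀ x, ENNReal.ofReal (F x) ≤ ∫⁻ ω, ENNReal.ofReal
      ((P.bondCurrent N k (P.solMap N T T s x (pairPath ω)) -
        P.bondCurrent N k (P.solMap N T T s (momentumFlip i (momentumFlip i' x)) (pairPath ω))) ^ 2) ∂wienerPair := by
    intro x
    refine le_trans (ENNReal.ofReal_le_ofReal
      (sq_kernel_sub_le_integral_sq hω hl.le hβ hγ hN0 hT k s x (momentumFlip i (momentumFlip i' x)))) ?_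
    exact ProfileAntitone.ofReal_integral_le_lintegral_ofReal' (ae_of_all _ fun _ => sq_nonneg _)
  show ∫ x, F x ∂μ ≤ ε
  by_cases hint : Integrable F μ
  · have h1 : ENNReal.ofReal (∫ x, F x ∂μ) ≤ ENNReal.ofReal ε :=
      calc ENNReal.ofReal (∫ x, F x ∂μ) = ∫⁻ x, ENNReal.ofReal (F x) ∂μ :=
            ofReal_integral_eq_lintegral_ofReal hint (ae_of_all _ hF0)
        _ ≤ _ := lintegral_mono hpt
        _ ≤ ENNReal.ofReal ε := key
    exact (ENNReal.ofReal_le_ofReal_iff hε.le).1 h1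
  · rw [integral_undef hint]
    exact hε.le

end Summit.AtomisticToContinuum.FouriersLaw.Theorems.NonBallistic

end
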